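import Summits.HodgeConjecture.HodgeConjecture.Theorems.Ring2WeilCoverageCMFieldAllPrimesK
import Summits.HodgeConjecture.HodgeConjecture.Theorems.Ring2WeilCoverageCMFieldAllPrimesD
import HarnessLib

/-!
# Weil-type components over quartic CM fields, IX (part L): `[ℓ] = [1]` for every prime `ℓ ≡ 1, 7 (mod 16)` in
# `ℚ(√-(2+√2))` — the complete prime classification `[ℓ] ≠ [1] ⟺ ℓ ≢ 1, 7 (mod 16), ℓ ≠ 2` of the sixth census field

research route conditional on HC_CM; not a corollary; Q11.4-sentence-2 already refuted in dim ≥ 3. Cell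
`pub-hodge-ring2`, seat `ring2-b03` (gen 52); conclusion of part K (`Ring2WeilCoverageCMFieldAllPrimesK`: degree-one
places of `E = ℚ(√-(2+√2)) = ℚ(ζ₁₆ - ζ₁₆⁻¹)` over `ℓ ≡ 1, 7 (mod 16)`, and the norm form
`Q = P₀² + 2(P₁² + P₂² + P₃²)` of `𝓞_E = ℤ[η]` on `z = (c₀ + c₁ρ) + (c₂ + c₃ρ)η`, `ρ = σ + 2 = ±√2`: divisibility, bound
`128·m⁴`, nonvanishing). Here, for Deligne's `R = S² + 4S + 2` (`F = ℚ(√2)`):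

1. (§1) the numerals: `[p] = [1]` for every prime `p ≡ 1, 7 (mod 16)` below `128` — `p ∈ {7, 17, 23, 71, 97, 103, 113}`,
   integer norm witnesses `(A + Bσ)² - σ(C + Dσ)² = p` (`71: (9, 1, 0, -1)`, `97: (11, 2, -2, -2)`,
   `103: (9, 1, -8, -1)`, `113: (9, 4, -12, -2)`; `7, 17, 23` as in gen 49);
2. (§2, PEELING) from `[k·ℓ] = [1]`, `1 ≤ k`: strip `2`'s (`[2] = [ρ²] = [1]`), primes `p ≡ 1, 7 (mod 16)` dividing `k`
   (hypothesis), squares of the remaining odd primes `q ≢ 1, 7 (mod 16)` — an odd power `q ∥ k` is impossible by the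
   non-split side for all primes (parts C/G: `[q·w] ≠ [1]`, `q ∤ w`) — down to `[ℓ] = [1]`;
3. (§3) **`[ℓ] = [1]` for EVERY prime `ℓ ≡ 1, 7 (mod 16)`**: a non-zero `z` in the four-variable Thue box (part I
   `box_four`, `f = ρ ↦ e² + 2`) dies at the degree-one place `η ↦ e` (part K), so `Q = Nm_{E/ℚ}(z) = kℓ`, `1 ≤ k ≤ 127`,
   and `Q = Nm_{E/F}(z·τz)` for the generator `τ : η ↦ (3+σ)η, σ ↦ -4-σ` of `Gal(E/ℚ) ≅ C₄` is exhibited by the integer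
   norm witness `A = c₀² - 2c₁² - 2c₂² + 4c₃²`, `B = 2c₃² - c₂²`, `C = 4c₀c₂ - 2c₀c₃ + 2c₁c₂ - 8c₁c₃`, `D = c₀c₂ - 2c₁c₃`
   (`A² - 2B² + 4CD - 8D² = Q`, `2AB - 4B² - C² + 8CD - 14D² = 0`), so `[kℓ] = [1]`; peel;
4. (§4) the **COMPLETE PRIME CLASSIFICATION for `ℚ(√-(2+√2))`: `[ℓ] ≠ [1] ⟺ ℓ ≠ 2 ∧ ℓ % 16 ∉ {1, 7}`** (with parts
   C/G), also with `R` literal, and **`[ℓ₁] = [ℓ₂] ⟺ ℓ₁ = ℓ₂ ∨ both totally split`** for arbitrary primes (with part D).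
   With parts E/F/J the prime classification is now complete for ALL SIX Galois census fields (`ℚ(ζ₅)`, `ℚ(ζ₈)`,
   `ℚ(ζ₁₂)`, `ℚ(√-3,√5)`, `ℚ(i,√5)`, `ℚ(√-(2+√2))`); only the non-Galois `D₄` field `ℚ(√-(3+√2))` keeps a
   non-congruence split condition. (Where the headers of parts D, G, K write «`ℓ ≢ ±1 (mod 16)`» read
   «`ℓ ≢ 1, 7 (mod 16)`» — the kernel binders are `ℓ % 16 ≠ 1 ∧ ℓ % 16 ≠ 7` throughout; ref1 A-159.1.)

No named fact, no definition, no `sorry`; nothing about the Hodge conjecture is asserted: `[ℓ] = [1]` says that the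
Weil-type component `W8.E.[ℓ]` of abelian eightfolds with `E`-signature `(2,2;2,2)` is the SPLIT one (Deligne Cor. 4.2),
whose general member is OPEN like every other row's. References: [Deligne1982HodgeCycles] §4 p. 30 (1), Cor. 4.2,
Lemma 4.6; [Landherr1936HermitianForms]. -/

noncomputable section

set_option linter.dupNamespace false

open Polynomial

namespace Summit.HodgeConjecture.HodgeConjecture.Ring2.WeilCoverageCM

open Literature.AlgebraicGeometry.Deligne1982
open Literature.AlgebraicGeometry.HodgeTheory (splitDiscriminantClassCM)

section SqrtNegTwoPlusSqrtTwo

variable {R : Polynomial ℤ} (hR : R = X ^ 2 + C 4 * X + C 2) [Fact (Irreducible (realPolyQ R))]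
include hR

/-! ### §1 The numerals: every prime `p ≡ 1, 7 (mod 16)` below `128` -/

/-- **Every prime `p ≡ 1, 7 (mod 16)` below `128` is split in `ℚ(√-(2+√2))`**: `p ∈ {7, 17, 23, 71, 97, 103, 113}`,
with the integer norm witnesses `(A, B, C, D)` = `(3,1,-2,-1)`, `(5,2,-2,0)`, `(3,1,-6,-1)`, `(9,1,0,-1)`, `(11,2,-2,-2)`,
`(9,1,-8,-1)`, `(9,4,-12,-2)` of `(A + Bσ)² - σ(C + Dσ)² = p` (`R = S² + 4S + 2`).
[cite: Deligne1982HodgeCycles, §4 p. 30 (1) and Cor. 4.2] -/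
theorem sqrtNegTwoPlusSqrtTwo_mk_prime_eq_splitDiscriminantClassCM_of_le (p : ℕ) (hp : p.Prime)
    (h16 : p % 16 = 1 ∨ p % 16 = 7) (h127 : p ≤ 127) (v : (realField R)ˣ) (hv : (v : realField R) = p) :
    (QuotientGroup.mk v : cmNormResidueGroup R) = splitDiscriminantClassCM R 2 := by
  haveI := fact_irreducible_cmPolyQ_sqrtNegTwoPlusSqrtTwo hR
  have hcases : p = 7 ∨ p = 17 ∨ p = 23 ∨ p = 71 ∨ p = 97 ∨ p = 103 ∨ p = 113 := by
    interval_cases p <;> first | omega | (exfalso; exact absurd hp (by norm_num))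
  have e : ∀ n : ℕ, (v : realField R) = n → (v : realField R) = AdjoinRoot.of (realPolyQ R) n := fun n h => by
    rw [h]; exact (map_natCast (AdjoinRoot.of (realPolyQ R)) n).symm
  rcases hcases with rfl | rfl | rfl | rfl | rfl | rfl | rfl
  · exact mk_eq_splitDiscriminantClassCM_two_of_coords hR 7 3 1 (-2) (-1) 1 one_ne_zero (by norm_num) (by norm_num) v
      (by rw [e 7 hv]; norm_num)
  · exact mk_eq_splitDiscriminantClassCM_two_of_coords hR 17 5 2 (-2) 0 1 one_ne_zero (by norm_num) (by norm_num) v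
      (by rw [e 17 hv]; norm_num)
  · exact mk_eq_splitDiscriminantClassCM_two_of_coords hR 23 3 1 (-6) (-1) 1 one_ne_zero (by norm_num) (by norm_num) v
      (by rw [e 23 hv]; norm_num)
  · exact mk_eq_splitDiscriminantClassCM_two_of_coords hR 71 9 1 0 (-1) 1 one_ne_zero (by norm_num) (by norm_num) v
      (by rw [e 71 hv]; norm_num)
  · exact mk_eq_splitDiscriminantClassCM_two_of_coords hR 97 11 2 (-2) (-2) 1 one_ne_zero (by norm_num) (by norm_num)
      v (by rw [e 97 hv]; norm_num)
  · exact mk_eq_splitDiscriminantClassCM_two_of_coords hR 103 9 1 (-8) (-1) 1 one_ne_zero (by norm_num) (by norm_num)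
      v (by rw [e 103 hv]; norm_num)
  · exact mk_eq_splitDiscriminantClassCM_two_of_coords hR 113 9 4 (-12) (-2) 1 one_ne_zero (by norm_num)
      (by norm_num) v (by rw [e 113 hv]; norm_num)

/-! ### §2 Peeling: from `[k·ℓ] = [1]` down to `[ℓ] = [1]` -/

/-- **Peeling.** `ℓ ≡ 1, 7 (mod 16)` prime; if `[k·ℓ] = [1]` with `1 ≤ k` and every prime `p ≡ 1, 7 (mod 16)` dividing
`k` has `[p] = [1]`, then `[ℓ] = [1]`: strip `2`'s (`[2] = [(2+σ)²] = [1]`), such `p`'s, and squares of the remaining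
odd primes `q ≢ 1, 7 (mod 16)` — an exact odd power `q ∥ k` is impossible by the non-split side (parts C/G,
`[q·w] ≠ [1]` for `q ∤ w`). [cite: Deligne1982HodgeCycles, §4 p. 30 (1) and Cor. 4.2] -/
theorem sqrtNegTwoPlusSqrtTwo_peel (ℓ : ℕ) (hℓ : ℓ.Prime) (hℓ16 : ℓ % 16 = 1 ∨ ℓ % 16 = 7) (k : ℕ) :
    1 ≤ k →
    (∀ p : ℕ, p.Prime → p ∣ k → (p % 16 = 1 ∨ p % 16 = 7) → ∀ v : (realField R)ˣ, (v : realField R) = p →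
      (QuotientGroup.mk v : cmNormResidueGroup R) = splitDiscriminantClassCM R 2) →
    (∀ v : (realField R)ˣ, (v : realField R) = ((k * ℓ : ℕ) : realField R) →
      (QuotientGroup.mk v : cmNormResidueGroup R) = splitDiscriminantClassCM R 2) →
    ∀ v : (realField R)ˣ, (v : realField R) = ℓ →
      (QuotientGroup.mk v : cmNormResidueGroup R) = splitDiscriminantClassCM R 2 := by
  haveI := fact_irreducible_cmPolyQ_sqrtNegTwoPlusSqrtTwo hR
  have hℓ1 : 1 ≤ ℓ := hℓ.one_lt.le
  induction k using Nat.strong_induction_on with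
  | _ k ih =>
  intro hk hp hsplit v hv
  by_cases hk1 : k = 1
  · subst hk1
    exact hsplit v (by rw [hv]; push_cast; ring)
  · -- `k ≥ 2`: peel the least prime factor `q`
    have hk2 : 2 ≤ k := by omega
    set q := k.minFac with hqdef
    have hq : q.Prime := Nat.minFac_prime hk1
    obtain ⟨k₁, hk₁⟩ : q ∣ k := Nat.minFac_dvd k
    have hk₁pos : 1 ≤ k₁ := by
      rcases Nat.eq_zero_or_pos k₁ with h | h
      · rw [h, mul_zero] at hk₁; omega
      · exact h
    have hq2 : 2 ≤ q := hq.two_le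
    have hk₁lt : k₁ < k := by
      rw [hk₁]; nlinarith
    have hp₁ : ∀ p : ℕ, p.Prime → p ∣ k₁ → (p % 16 = 1 ∨ p % 16 = 7) → ∀ v : (realField R)ˣ, (v : realField R) = p →
        (QuotientGroup.mk v : cmNormResidueGroup R) = splitDiscriminantClassCM R 2 :=
      fun p hp' hpd => hp p hp' (hk₁ ▸ Dvd.dvd.mul_left hpd q)
    -- the factorisation `k ℓ = q · (k₁ ℓ)`
    have hfac : k * ℓ = q * (k₁ * ℓ) := by rw [hk₁]; ring
    -- case A: `[q] = [1]` is known (`q = 2` or `q ≡ 1, 7 (mod 16)`): strip it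
    have caseA : (∀ w : (realField R)ˣ, (w : realField R) = q →
        (QuotientGroup.mk w : cmNormResidueGroup R) = splitDiscriminantClassCM R 2) →
        (QuotientGroup.mk v : cmNormResidueGroup R) = splitDiscriminantClassCM R 2 := by
      intro hsq
      refine ih k₁ hk₁lt hk₁pos hp₁ ?_ v hv
      intro w hw
      exact natCast_split_of_mul_of_left q (k₁ * ℓ) (by omega) hsq
        (fun w' hw' => hsplit w' (by rw [hw', hfac])) w hw
    -- case B: `q² ∣ k`: strip the square
    have caseB : q ∣ k₁ → (QuotientGroup.mk v : cmNormResidueGroup R) = splitDiscriminantClassCM R 2 := by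
      rintro ⟨k₂, hk₂⟩
      have hk₂pos : 1 ≤ k₂ := by
        rcases Nat.eq_zero_or_pos k₂ with h | h
        · rw [h, mul_zero] at hk₂; omega
        · exact h
      have hk₂lt : k₂ < k := by rw [hk₁, hk₂]; nlinarith
      have hp₂ : ∀ p : ℕ, p.Prime → p ∣ k₂ → (p % 16 = 1 ∨ p % 16 = 7) → ∀ v : (realField R)ˣ,
          (v : realField R) = p → (QuotientGroup.mk v : cmNormResidueGroup R) = splitDiscriminantClassCM R 2 :=
        fun p hp' hpd => hp₁ p hp' (hk₂ ▸ Dvd.dvd.mul_left hpd q)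
      refine ih k₂ hk₂lt hk₂pos hp₂ ?_ v hv
      intro w hw
      refine natCast_split_of_sq_mul q (k₂ * ℓ) (by omega) (fun w' hw' => hsplit w' ?_) w hw
      rw [hw', hk₁, hk₂]; push_cast; ring
    by_cases hqtwo : q = 2
    · -- `[2] = [(2 + σ)²] = [1]`
      refine caseA (fun w hw => mk_eq_splitDiscriminantClassCM_two_of_coords hR 2 2 1 0 0 1 one_ne_zero
        (by norm_num) (by norm_num) w ?_)
      rw [hw, hqtwo]; exact (map_natCast (AdjoinRoot.of (realPolyQ R)) 2).symm.trans (by norm_num)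
    by_cases hq16 : q % 16 = 1 ∨ q % 16 = 7
    · exact caseA (hp q hq ⟨k₁, hk₁⟩ hq16)
    by_cases hqk₁ : q ∣ k₁
    · exact caseB hqk₁
    · -- `q` odd, `q ≢ 1, 7 (mod 16)`, `q ∥ k ℓ`: impossible by the non-split side (parts C/G)
      exfalso
      have hqℓ : ¬ q ∣ ℓ := fun h => by
        rcases (Nat.dvd_prime hℓ).1 h with h' | h' <;> omega
      have hndvd : ¬ (q : ℤ) ∣ ((k₁ * ℓ : ℕ) : ℤ) := by
        intro h
        have h' : q ∣ k₁ * ℓ := by exact_mod_cast h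
        rcases (Nat.Prime.dvd_mul hq).1 h' with h'' | h''
        · exact hqk₁ h''
        · exact hqℓ h''
      have hprod : 1 ≤ k * ℓ := by
        have := Nat.mul_le_mul hk hℓ1
        simpa using this
      have hu := hsplit (Units.mk0 (((k * ℓ : ℕ)) : realField R) (natCast_ne_zero_realField _ hprod))
        (Units.val_mk0 _)
      have h16a : q % 16 ≠ 1 := fun h => hq16 (Or.inl h)
      have h16b : q % 16 ≠ 7 := fun h => hq16 (Or.inr h)
      exact sqrtNegTwoPlusSqrtTwo_mk_prime_mul_ne_splitDiscriminantClassCM_of_mod_sixteen_ne hR q hq hqtwo h16a h16b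
        ((k₁ * ℓ : ℕ) : ℤ) hndvd _
        (by rw [Units.val_mk0, hfac]; push_cast; simp only [map_mul, map_natCast]) hu

/-! ### §3 The main theorem -/

/-- **`[ℓ] = [1]` for `E = ℚ(√-(2+√2))` and EVERY prime `ℓ ≡ 1, 7 (mod 16)`** (the primes totally split in
`E = ℚ(ζ₁₆)^{⟨7⟩}`): a non-zero `z = (c₀ + c₁ρ) + (c₂ + c₃ρ)η` in the Thue box (part I `box_four` with `f = e² + 2`)
dies at a degree-one place over `ℓ` (part K), so `Q = Nm_{E/ℚ}(z) = kℓ` with `1 ≤ k ≤ 127` (bound `128m⁴ < 128ℓ`,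
nonvanishing); `Q = Nm_{E/F}(z·τz)` is exhibited by the integer norm witness `(A, B, C, D)`
(`A² - 2B² + 4CD - 8D² = Q`, `2AB - 4B² - C² + 8CD - 14D² = 0`), so `[kℓ] = [1]`; peel (§2) using the numerals for
the primes `p ≡ 1, 7 (mod 16)`, `p ≤ 127` (for `ℓ ≤ 127` the theorem is itself one of those numerals). Hence the
Weil-type component `W8.E.[ℓ]` is the SPLIT one for `ℓ = 2, 7, 17, 23, 71, 97, 103, 113, 137, …`.
[cite: Deligne1982HodgeCycles, §4 p. 30 (1) and Cor. 4.2] [cite: Landherr1936HermitianForms] -/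
theorem sqrtNegTwoPlusSqrtTwo_mk_prime_eq_splitDiscriminantClassCM_of_mod_sixteen (ℓ : ℕ) (hℓ : ℓ.Prime)
    (hℓ16 : ℓ % 16 = 1 ∨ ℓ % 16 = 7) (u : (realField R)ˣ) (hu : (u : realField R) = ℓ) :
    (QuotientGroup.mk u : cmNormResidueGroup R) = splitDiscriminantClassCM R 2 := by
  haveI : Fact ℓ.Prime := ⟨hℓ⟩
  haveI := fact_irreducible_cmPolyQ_sqrtNegTwoPlusSqrtTwo hR
  by_cases hsmall : ℓ ≤ 127
  · exact sqrtNegTwoPlusSqrtTwo_mk_prime_eq_splitDiscriminantClassCM_of_le hR ℓ hℓ hℓ16 hsmall u hu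
  -- a degree-one place and the Thue box
  obtain ⟨e, he⟩ := exists_root_cmPoly_sqrtNegTwoPlusSqrtTwo (ℓ := ℓ) hℓ16
  obtain ⟨m, hm, c₀, c₁, c₂, c₃, hne, h₀, h₁, h₂, h₃, hL⟩ := box_four (ℓ := ℓ) (e ^ 2 + 2) e
  -- `Q = kℓ`
  have hQ0 := sqrtNegTwoPlusSqrtTwo_normForm_zmod_eq_zero e he c₀ c₁ c₂ c₃ hL
  rw [ZMod.intCast_zmod_eq_zero_iff_dvd] at hQ0
  obtain ⟨k, hk⟩ := hQ0
  have hQle := sqrtNegTwoPlusSqrtTwo_normForm_le m c₀ c₁ c₂ c₃ h₀ h₁ h₂ h₃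
  have hQne := sqrtNegTwoPlusSqrtTwo_normForm_ne_zero c₀ c₁ c₂ c₃ hne
  have hQnn : (0 : ℤ) ≤ (c₀ ^ 2 - 2 * c₁ ^ 2) ^ 2 + 2 * ((c₀ * c₂ - 2 * c₀ * c₃ + 2 * c₁ * c₂ - 2 * c₁ * c₃) ^ 2
      + (c₀ * c₂ - 2 * c₁ * c₃) ^ 2 + (c₂ ^ 2 - 2 * c₃ ^ 2) ^ 2) := by positivity
  have hm4 : ((m : ℤ)) ^ 4 < ℓ := by exact_mod_cast hm
  have hℓpos : (0 : ℤ) < ℓ := by exact_mod_cast hℓ.pos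
  have hk1 : 1 ≤ k := by
    by_contra h
    rw [not_le] at h
    have : (ℓ : ℤ) * k ≤ 0 := by nlinarith
    rw [← hk] at this
    exact hQne (le_antisymm this hQnn)
  have hk127 : k ≤ 127 := by
    by_contra h
    rw [not_le] at h
    have : (ℓ : ℤ) * 128 ≤ ℓ * k := by nlinarith
    nlinarith
  obtain ⟨kn, rfl⟩ := Int.eq_ofNat_of_zero_le (by omega : (0 : ℤ) ≤ k)
  have hkn1 : 1 ≤ kn := by exact_mod_cast hk1
  have hkn : kn ≤ 127 := by exact_mod_cast hk127
  -- `[kℓ] = [1]` by the norm witness `z·τz`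
  have hsplit : ∀ v : (realField R)ˣ, (v : realField R) = ((kn * ℓ : ℕ) : realField R) →
      (QuotientGroup.mk v : cmNormResidueGroup R) = splitDiscriminantClassCM R 2 := by
    intro v hv
    refine mk_eq_splitDiscriminantClassCM_two_of_coords hR ((kn : ℤ) * ℓ)
      (c₀ ^ 2 - 2 * c₁ ^ 2 - 2 * c₂ ^ 2 + 4 * c₃ ^ 2) (2 * c₃ ^ 2 - c₂ ^ 2)
      (4 * c₀ * c₂ - 2 * c₀ * c₃ + 2 * c₁ * c₂ - 8 * c₁ * c₃) (c₀ * c₂ - 2 * c₁ * c₃) 1 one_ne_zero ?_ (by ring) v ?_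
    · rw [mul_comm (kn : ℤ) ℓ, ← hk]; ring
    · rw [hv]; push_cast; simp only [map_mul, map_natCast]
  refine sqrtNegTwoPlusSqrtTwo_peel hR ℓ hℓ hℓ16 kn hkn1 ?_ hsplit u hu
  intro p hp hpk hp16 v hv
  exact sqrtNegTwoPlusSqrtTwo_mk_prime_eq_splitDiscriminantClassCM_of_le hR p hp hp16
    ((Nat.le_of_dvd (by omega) hpk).trans hkn) v hv

/-! ### §4 The complete classification for `ℚ(√-(2+√2))` -/

/-- **COMPLETE PRIME CLASSIFICATION for `E = ℚ(√-(2+√2))`: for every prime `ℓ`,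
`[ℓ] ≠ [1] ⟺ ℓ ≠ 2 ∧ ℓ % 16 ≠ 1 ∧ ℓ % 16 ≠ 7`** — the Weil-type component `W8.E.[ℓ]` is the SPLIT one exactly for
`ℓ = 2` and the primes `ℓ ≡ 1, 7 (mod 16)` (§3), and NON-SPLIT for every prime `ℓ ≢ 1, 7 (mod 16)`, `ℓ ≠ 2`
(parts C and G). [cite: Deligne1982HodgeCycles, §4 p. 30 (1) and Cor. 4.2] [cite: Landherr1936HermitianForms] -/
theorem sqrtNegTwoPlusSqrtTwo_mk_prime_ne_splitDiscriminantClassCM_iff (ℓ : ℕ) (hℓ : ℓ.Prime) (u : (realField R)ˣ)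
    (hu : (u : realField R) = ℓ) :
    (QuotientGroup.mk u : cmNormResidueGroup R) ≠ splitDiscriminantClassCM R 2 ↔
      (ℓ ≠ 2 ∧ ℓ % 16 ≠ 1 ∧ ℓ % 16 ≠ 7) := by
  haveI := fact_irreducible_cmPolyQ_sqrtNegTwoPlusSqrtTwo hR
  constructor
  · intro hne
    refine ⟨?_,
      fun h1 => hne (sqrtNegTwoPlusSqrtTwo_mk_prime_eq_splitDiscriminantClassCM_of_mod_sixteen hR ℓ hℓ (Or.inl h1) u hu),
      fun h7 => hne (sqrtNegTwoPlusSqrtTwo_mk_prime_eq_splitDiscriminantClassCM_of_mod_sixteen hR ℓ hℓ (Or.inr h7) u hu)⟩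
    rintro rfl
    exact hne (mk_eq_splitDiscriminantClassCM_two_of_coords hR 2 2 1 0 0 1 one_ne_zero (by norm_num) (by norm_num) u
      (by rw [hu]; exact (map_natCast (AdjoinRoot.of (realPolyQ R)) 2).symm.trans (by norm_num)))
  · rintro ⟨h2, h1, h7⟩
    exact sqrtNegTwoPlusSqrtTwo_mk_prime_ne_splitDiscriminantClassCM_of_mod_sixteen_ne hR ℓ hℓ h2 h1 h7 u hu

/-- **The split primes of `ℚ(√-(2+√2))`**: `[ℓ] = [1]` for `ℓ = 2` (`2 = (2+σ)²`) and for every prime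
`ℓ ≡ 1, 7 (mod 16)` (§3) — the «split type» `ℓ = 2 ∨ ℓ % 16 ∈ {1, 7}` of the classification.
[cite: Deligne1982HodgeCycles, §4 p. 30 (1) and Cor. 4.2] -/
theorem sqrtNegTwoPlusSqrtTwo_mk_prime_eq_splitDiscriminantClassCM_of_splitType (ℓ : ℕ) (hℓ : ℓ.Prime)
    (hs : ℓ = 2 ∨ ℓ % 16 = 1 ∨ ℓ % 16 = 7) (u : (realField R)ˣ) (hu : (u : realField R) = ℓ) :
    (QuotientGroup.mk u : cmNormResidueGroup R) = splitDiscriminantClassCM R 2 := by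
  haveI := fact_irreducible_cmPolyQ_sqrtNegTwoPlusSqrtTwo hR
  by_contra hne
  obtain ⟨h2, h1, h7⟩ := (sqrtNegTwoPlusSqrtTwo_mk_prime_ne_splitDiscriminantClassCM_iff hR ℓ hℓ u hu).1 hne
  rcases hs with h | h | h
  · exact h2 h
  · exact h1 h
  · exact h7 h

/-- **The non-split primes of `ℚ(√-(2+√2))`**: `[ℓ] ≠ [1]` for every prime outside the split type
(`ℓ ≠ 2`, `ℓ % 16 ∉ {1, 7}`; parts C/G). [cite: Deligne1982HodgeCycles, §4 p. 30 (1) and Cor. 4.2] -/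
theorem sqrtNegTwoPlusSqrtTwo_mk_prime_ne_splitDiscriminantClassCM_of_not_splitType (ℓ : ℕ) (hℓ : ℓ.Prime)
    (hs : ¬ (ℓ = 2 ∨ ℓ % 16 = 1 ∨ ℓ % 16 = 7)) (u : (realField R)ˣ) (hu : (u : realField R) = ℓ) :
    (QuotientGroup.mk u : cmNormResidueGroup R) ≠ splitDiscriminantClassCM R 2 :=
  (sqrtNegTwoPlusSqrtTwo_mk_prime_ne_splitDiscriminantClassCM_iff hR ℓ hℓ u hu).2
    ⟨fun h => hs (Or.inl h), fun h => hs (Or.inr (Or.inl h)), fun h => hs (Or.inr (Or.inr h))⟩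

/-- **`[ℓ₁] = [ℓ₂] ⟺ ℓ₁ = ℓ₂ ∨ both are of split type`** for ARBITRARY primes `ℓ₁, ℓ₂` in `ℚ(√-(2+√2))` (split
type: `ℓ = 2` or `ℓ ≡ 1, 7 (mod 16)`, the primes with `[ℓ] = [1]`; the other primes give pairwise distinct non-split
classes, part D) — the complete row structure of the prime classes of the sixth census table.
[cite: Deligne1982HodgeCycles, §4 p. 30 (1) and Cor. 4.2] -/
theorem sqrtNegTwoPlusSqrtTwo_mk_prime_eq_mk_prime_iff_of_prime {ℓ₁ ℓ₂ : ℕ} (h₁ : ℓ₁.Prime) (h₂ : ℓ₂.Prime)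
    (u v : (realField R)ˣ) (hu : (u : realField R) = ℓ₁) (hv : (v : realField R) = ℓ₂) :
    (QuotientGroup.mk u : cmNormResidueGroup R) = QuotientGroup.mk v ↔
      (ℓ₁ = ℓ₂ ∨ ((ℓ₁ = 2 ∨ ℓ₁ % 16 = 1 ∨ ℓ₁ % 16 = 7) ∧ (ℓ₂ = 2 ∨ ℓ₂ % 16 = 1 ∨ ℓ₂ % 16 = 7))) := by
  haveI := fact_irreducible_cmPolyQ_sqrtNegTwoPlusSqrtTwo hR
  by_cases hs₁ : ℓ₁ = 2 ∨ ℓ₁ % 16 = 1 ∨ ℓ₁ % 16 = 7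
  · by_cases hs₂ : ℓ₂ = 2 ∨ ℓ₂ % 16 = 1 ∨ ℓ₂ % 16 = 7
    · refine ⟨fun _ => Or.inr ⟨hs₁, hs₂⟩, fun _ => ?_⟩
      rw [sqrtNegTwoPlusSqrtTwo_mk_prime_eq_splitDiscriminantClassCM_of_splitType hR ℓ₁ h₁ hs₁ u hu,
        sqrtNegTwoPlusSqrtTwo_mk_prime_eq_splitDiscriminantClassCM_of_splitType hR ℓ₂ h₂ hs₂ v hv]
    · constructor
      · intro huv
        exact absurd (huv.symm.trans
          (sqrtNegTwoPlusSqrtTwo_mk_prime_eq_splitDiscriminantClassCM_of_splitType hR ℓ₁ h₁ hs₁ u hu))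
          (sqrtNegTwoPlusSqrtTwo_mk_prime_ne_splitDiscriminantClassCM_of_not_splitType hR ℓ₂ h₂ hs₂ v hv)
      · rintro (rfl | ⟨-, h⟩)
        · exact absurd hs₁ hs₂
        · exact absurd h hs₂
  · by_cases hs₂ : ℓ₂ = 2 ∨ ℓ₂ % 16 = 1 ∨ ℓ₂ % 16 = 7
    · constructor
      · intro huv
        exact absurd (huv.trans
          (sqrtNegTwoPlusSqrtTwo_mk_prime_eq_splitDiscriminantClassCM_of_splitType hR ℓ₂ h₂ hs₂ v hv))
          (sqrtNegTwoPlusSqrtTwo_mk_prime_ne_splitDiscriminantClassCM_of_not_splitType hR ℓ₁ h₁ hs₁ u hu)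
      · rintro (rfl | ⟨h, -⟩)
        · exact absurd hs₂ hs₁
        · exact absurd h hs₁
    · rw [sqrtNegTwoPlusSqrtTwo_mk_prime_eq_mk_prime_iff hR h₁ (fun h => hs₁ (Or.inl h))
        (fun h => hs₁ (Or.inr (Or.inl h))) (fun h => hs₁ (Or.inr (Or.inr h))) h₂ (fun h => hs₂ (Or.inl h))
        (fun h => hs₂ (Or.inr (Or.inl h))) (fun h => hs₂ (Or.inr (Or.inr h))) u v hu hv]
      exact ⟨Or.inl, fun h => h.elim id fun h' => absurd h'.1 hs₁⟩

end SqrtNegTwoPlusSqrtTwo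

/-! ### §5 `R` literal: the sixth census field -/

/-- **`ℚ(√-(2+√2))` (`R = S² + 4S + 2` literally): for every prime `ℓ`, `[ℓ] ≠ [1] ⟺ ℓ ≠ 2 ∧ ℓ % 16 ∉ {1, 7}`** — the
sixth row of the census's complete prime classifications (parts E/F: `ℚ(ζ₈)`, `ℚ(ζ₁₂)`, `ℚ(i,√5)`, `ℚ(√-3,√5)`;
part J: `ℚ(ζ₅)`). [cite: Deligne1982HodgeCycles, §4 p. 30 (1) and Cor. 4.2] [cite: Landherr1936HermitianForms] -/
theorem sqrtNegTwoPlusSqrtTwo_prime_classification (ℓ : ℕ) (hℓ : ℓ.Prime) :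
    haveI := fact_irreducible_realPolyQ_of_not_sq (R := X ^ 2 + C 4 * X + C 2) rfl disc_not_sq_four_two
    ∀ u : (realField (X ^ 2 + C 4 * X + C 2))ˣ, (u : realField (X ^ 2 + C 4 * X + C 2)) = ℓ →
      ((QuotientGroup.mk u : cmNormResidueGroup (X ^ 2 + C 4 * X + C 2)) ≠
          splitDiscriminantClassCM (X ^ 2 + C 4 * X + C 2) 2 ↔ (ℓ ≠ 2 ∧ ℓ % 16 ≠ 1 ∧ ℓ % 16 ≠ 7)) := by
  haveI := fact_irreducible_realPolyQ_of_not_sq (R := X ^ 2 + C 4 * X + C 2) rfl disc_not_sq_four_two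
  exact fun u hu => sqrtNegTwoPlusSqrtTwo_mk_prime_ne_splitDiscriminantClassCM_iff rfl ℓ hℓ u hu

end Summit.HodgeConjecture.HodgeConjecture.Ring2.WeilCoverageCM

end
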